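import Summits.QuantumFields.YangMills.Theorems.AtomicSynthesisMolliTaylorLine
import Literature.MathematicalPhysics.AQFT.OSAxiomsSchwinger

/-!
# AtomicCalibrationR (stmt-QuantumFields-28169), E2 `stub_offDiagonalWhitney` — Taylor FLATNESS of `⁰𝒮` test functions
# at the fat diagonal (Plan A, step 2 of planner ym-idea-11 g15's `STUB-PLAN-offDiagonalWhitney.md`)

Prover w4 g22 (free hands), helper toward the pure-analysis stub E2 (`WhitneyPkg`) of LINES «AtomicEngine» / «MirrorCalibration»
on the support item `OnsetTautology.AtomicCalibrationR`.  The one piece of real analysis in the Whitney synthesis is that an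
off-diagonal test function (`IsOffDiagonal`: all derivatives vanish at coincident points) is FLAT near the fat diagonal: its
`m`-th derivative at `z` is bounded by a `K`-th Schwartz seminorm times `dist(z, Δ)^{K−m}`.  Here, with Mathlib + the tree's
Taylor-along-a-line estimate (`AtomicSynthesisMolli.norm_sub_taylor_line_le`, prover w3 g36):

* `norm_iteratedFDeriv_iteratedFDeriv` — `‖D^j (D^m g)(x)‖ = ‖D^{j+m} g(x)‖` (curry-left isometries);
* `norm_le_of_jets_eq_zero` — if `g ∈ C^∞` has vanishing jets of orders `≤ n` at `w₀` and `‖D^{n+1} g‖ ≤ B` everywhere, then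
  `‖g z‖ ≤ B ‖z − w₀‖^{n+1} / n!`;
* `norm_iteratedFDeriv_le_of_jets_eq_zero` — the same for `D^m g` (`m < K`, all jets at `w₀` vanishing, `‖D^K g‖ ≤ B`):
  `‖D^m g(z)‖ ≤ B ‖z − w₀‖^{K−m} / (K−m−1)!`;
* `IsOffDiagonal.norm_iteratedFDeriv_le_of_mem` — for `F ∈ ⁰𝒮` and `w₀` on the coincidence locus:
  `‖D^m F(z)‖ ≤ seminorm(0,K)(F) · ‖z − w₀‖^{K−m}/(K−m−1)!`;
* `IsOffDiagonal.norm_iteratedFDeriv_le_of_pair` — for every pair of slots `l ≠ l'`, via the averaged point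
  `w₀ = z[l, l' ↦ (z_l + z_{l'})/2] ∈ Δ` with `‖z − w₀‖ ≤ ‖z_l − z_{l'}‖/2`:
  `‖D^m F(z)‖ ≤ seminorm(0,K)(F) · (‖z_l − z_{l'}‖/2)^{K−m}/(K−m−1)!`.

Def-free.  No stub/crux/rung/summit is closed by this file; nothing here touches Yang–Mills; the YM mass gap is NOT proved.
Refs: Stein, *Singular Integrals* VI §1 (context); Kravchuk–Qiao–Rychkov 2021 Remark 2.4 (`⁰𝒮`). [folklore]
-/

set_option autoImplicit false

noncomputable section

open scoped BigOperators ContDiff Nat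
open Set Metric
open Summit.QuantumFields.YangMills.Theorems.AtomicSynthesisMolli (norm_sub_taylor_line_le)
open Literature.MathematicalPhysics.AQFT (coincidenceLocus IsOffDiagonal)

namespace Summit.QuantumFields.YangMills.Cruxes.AtomicCalibrationR.OffDiagonalFlatness

variable {E : Type} [NormedAddCommGroup E] [NormedSpace ℝ E]

/-! ## Norms of iterated derivatives of iterated derivatives -/

/-- **`‖D^j (D^m g)(x)‖ = ‖D^{j+m} g(x)‖.**  Induction on `m` through `D^{m+1} g = ι ∘ D(D^m g)` with `ι` a linear isometry
(`iteratedFDeriv_succ_eq_comp_left`). [folklore] -/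
theorem norm_iteratedFDeriv_iteratedFDeriv {F : Type} [NormedAddCommGroup F] [NormedSpace ℝ F] (g : E → F) (j m : ℕ)
    (x : E) : ‖iteratedFDeriv ℝ j (iteratedFDeriv ℝ m g) x‖ = ‖iteratedFDeriv ℝ (j + m) g x‖ := by
  induction m generalizing F j with
  | zero =>
    rw [add_zero, iteratedFDeriv_zero_eq_comp, LinearIsometryEquiv.norm_iteratedFDeriv_comp_left]
  | succ m ih =>
    have h1 : ‖iteratedFDeriv ℝ j (iteratedFDeriv ℝ (m + 1) g) x‖ =
        ‖iteratedFDeriv ℝ j (iteratedFDeriv ℝ m fun y => fderiv ℝ g y) x‖ := by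
      have hiso := (continuousMultilinearCurryRightEquiv' ℝ m E F).symm.norm_iteratedFDeriv_comp_left
        (iteratedFDeriv ℝ m fun y => fderiv ℝ g y) x j
      rw [← hiso]
      congr 2
      funext y
      exact iteratedFDeriv_succ_eq_comp_right
    rw [h1, ih (fun y => fderiv ℝ g y) j]
    have e : (fun y => fderiv ℝ g y) = fderiv ℝ g := rfl
    rw [e, norm_iteratedFDeriv_fderiv, Nat.add_assoc]

/-- Vanishing of all jets propagates to the jets of every iterated derivative. -/
theorem iteratedFDeriv_iteratedFDeriv_eq_zero {F : Type} [NormedAddCommGroup F] [NormedSpace ℝ F] (g : E → F)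
    {w₀ : E} (h : ∀ k : ℕ, iteratedFDeriv ℝ k g w₀ = 0) (j m : ℕ) : iteratedFDeriv ℝ j (iteratedFDeriv ℝ m g) w₀ = 0 := by
  rw [← norm_eq_zero, norm_iteratedFDeriv_iteratedFDeriv, h, norm_zero]

/-! ## Flatness from vanishing jets -/

/-- **Flatness from vanishing jets.**  If `g ∈ C^∞` has `D^j g(w₀) = 0` for `j ≤ n` and `‖D^{n+1} g‖ ≤ B` everywhere, then
`‖g z‖ ≤ B ‖z − w₀‖^{n+1} / n!` (Taylor along the segment from `w₀` to `z`; all Taylor coefficients vanish). [folklore] -/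
theorem norm_le_of_jets_eq_zero {F : Type} [NormedAddCommGroup F] [NormedSpace ℝ F] (g : E → F) (hg : ContDiff ℝ ∞ g)
    (w₀ z : E) (n : ℕ) (hjet : ∀ j : ℕ, j ≤ n → iteratedFDeriv ℝ j g w₀ = 0) {B : ℝ}
    (hB : ∀ y, ‖iteratedFDeriv ℝ (n + 1) g y‖ ≤ B) : ‖g z‖ ≤ B * ‖z - w₀‖ ^ (n + 1) / n ! := by
  have h := norm_sub_taylor_line_le hg w₀ (z - w₀) one_pos n hB
  have hsum : ∑ j ∈ Finset.range (n + 1), ((j ! : ℝ)⁻¹ * (1 : ℝ) ^ j) • iteratedFDeriv ℝ j g w₀ (fun _ => z - w₀) = 0 := by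
    refine Finset.sum_eq_zero fun j hj => ?_
    rw [hjet j (Nat.lt_succ_iff.mp (Finset.mem_range.mp hj)), zero_apply, smul_zero]
  rw [hsum, sub_zero, one_smul, add_sub_cancel, one_pow, mul_one] at h
  exact h

/-- **Flatness of the derivatives from vanishing jets.**  If all jets of `g ∈ C^∞` vanish at `w₀` and `‖D^K g‖ ≤ B` everywhere,
then for `m < K`: `‖D^m g(z)‖ ≤ B ‖z − w₀‖^{K−m} / (K−m−1)!`. [folklore] -/
theorem norm_iteratedFDeriv_le_of_jets_eq_zero {F : Type} [NormedAddCommGroup F] [NormedSpace ℝ F] (g : E → F)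
    (hg : ContDiff ℝ ∞ g) (w₀ z : E) (hjet : ∀ k : ℕ, iteratedFDeriv ℝ k g w₀ = 0) {K m : ℕ} (hm : m < K) {B : ℝ}
    (hB : ∀ y, ‖iteratedFDeriv ℝ K g y‖ ≤ B) :
    ‖iteratedFDeriv ℝ m g z‖ ≤ B * ‖z - w₀‖ ^ (K - m) / (K - m - 1) ! := by
  obtain ⟨n, hn⟩ : ∃ n : ℕ, K = n + 1 + m := ⟨K - m - 1, by omega⟩
  have hKm : K - m = n + 1 := by omega
  have hKm1 : K - m - 1 = n := by omega
  rw [hKm1, hKm]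
  refine norm_le_of_jets_eq_zero (iteratedFDeriv ℝ m g) (hg.iteratedFDeriv_right (by exact_mod_cast le_top)) w₀ z n
    (fun j _ => iteratedFDeriv_iteratedFDeriv_eq_zero g hjet j m) fun y => ?_
  rw [norm_iteratedFDeriv_iteratedFDeriv, ← hn]
  exact hB y

/-! ## `⁰𝒮` test functions -/

variable {n : ℕ}

/-- **Flatness of `⁰𝒮` functions at the coincidence locus.**  For `F ∈ ⁰𝒮((E)ⁿ)` and `w₀ ∈ Δ`, `m < K`:
`‖D^m F(z)‖ ≤ p_{0,K}(F) · ‖z − w₀‖^{K−m} / (K−m−1)!`, `p_{0,K}` the Schwartz seminorm `sup ‖D^K F‖`. [folklore] -/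
theorem _root_.Literature.MathematicalPhysics.AQFT.IsOffDiagonal.norm_iteratedFDeriv_le_of_mem
    {F : SchwartzMap (Fin n → E) ℂ} (hF : IsOffDiagonal F) {w₀ : Fin n → E} (hw₀ : w₀ ∈ coincidenceLocus n E)
    {K m : ℕ} (hm : m < K) (z : Fin n → E) :
    ‖iteratedFDeriv ℝ m F z‖ ≤ SchwartzMap.seminorm ℝ 0 K F * ‖z - w₀‖ ^ (K - m) / (K - m - 1) ! :=
  norm_iteratedFDeriv_le_of_jets_eq_zero (F : (Fin n → E) → ℂ) (F.smooth _) w₀ z (hF w₀ hw₀) hm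
    (fun y => SchwartzMap.norm_iteratedFDeriv_le_seminorm ℝ F K y)

/-- The point of the fat diagonal obtained by averaging two slots. -/
theorem average_mem_coincidenceLocus (z : Fin n → E) {l l' : Fin n} (hll' : l ≠ l') :
    Function.update (Function.update z l ((2 : ℝ)⁻¹ • (z l + z l'))) l' ((2 : ℝ)⁻¹ • (z l + z l')) ∈
      coincidenceLocus n E := by
  refine ⟨l, l', hll', ?_⟩
  rw [Function.update_self, Function.update_of_ne hll', Function.update_self]

/-- Distance from `z` to its two-slot average: at most half the slot difference (sup norm over slots). -/
theorem norm_sub_average_le (z : Fin n → E) {l l' : Fin n} (hll' : l ≠ l') :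
    ‖z - Function.update (Function.update z l ((2 : ℝ)⁻¹ • (z l + z l'))) l' ((2 : ℝ)⁻¹ • (z l + z l'))‖ ≤
      ‖z l - z l'‖ / 2 := by
  refine (pi_norm_le_iff_of_nonneg (by positivity)).2 fun i => ?_
  rw [Pi.sub_apply]
  by_cases hi' : i = l'
  · subst hi'
    rw [Function.update_self]
    have : z i - (2 : ℝ)⁻¹ • (z l + z i) = (2 : ℝ)⁻¹ • (z i - z l) := by
      rw [smul_sub, smul_add]; module
    rw [this, norm_smul, Real.norm_eq_abs, abs_of_pos (by norm_num : (0 : ℝ) < 2⁻¹), norm_sub_rev]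
    linarith [norm_nonneg (z l - z i)]
  · rw [Function.update_of_ne hi']
    by_cases hi : i = l
    · subst hi
      rw [Function.update_self]
      have : z i - (2 : ℝ)⁻¹ • (z i + z l') = (2 : ℝ)⁻¹ • (z i - z l') := by
        rw [smul_sub, smul_add]; module
      rw [this, norm_smul, Real.norm_eq_abs, abs_of_pos (by norm_num : (0 : ℝ) < 2⁻¹)]
      linarith [norm_nonneg (z i - z l')]
    · rw [Function.update_of_ne hi, sub_self, norm_zero]
      positivity

/-- **Flatness of `⁰𝒮` functions off the fat diagonal, pair form.**  For `F ∈ ⁰𝒮((E)ⁿ)`, every pair of slots `l ≠ l'` and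
`m < K`: `‖D^m F(z)‖ ≤ p_{0,K}(F) · (‖z_l − z_{l'}‖/2)^{K−m} / (K−m−1)!`.  (Taking the minimum over pairs gives the flatness in
terms of the sup-norm distance to the fat diagonal used by the Whitney synthesis.) [folklore] -/
theorem _root_.Literature.MathematicalPhysics.AQFT.IsOffDiagonal.norm_iteratedFDeriv_le_of_pair
    {F : SchwartzMap (Fin n → E) ℂ} (hF : IsOffDiagonal F) {l l' : Fin n} (hll' : l ≠ l') {K m : ℕ} (hm : m < K)
    (z : Fin n → E) :
    ‖iteratedFDeriv ℝ m F z‖ ≤ SchwartzMap.seminorm ℝ 0 K F * (‖z l - z l'‖ / 2) ^ (K - m) / (K - m - 1) ! := by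
  have h := hF.norm_iteratedFDeriv_le_of_mem (average_mem_coincidenceLocus z hll') hm z
  refine h.trans ?_
  have hp : 0 ≤ SchwartzMap.seminorm ℝ 0 K F := apply_nonneg _ _
  have hd := norm_sub_average_le z hll'
  have hfac : (0 : ℝ) < (K - m - 1) ! := by positivity
  rw [div_le_div_iff_of_pos_right hfac]
  exact mul_le_mul_of_nonneg_left (pow_le_pow_left₀ (norm_nonneg _) hd _) hp

end Summit.QuantumFields.YangMills.Cruxes.AtomicCalibrationR.OffDiagonalFlatness

end
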